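import Mathlib
import Summits.Ventures.PercRepro2.Defs
import Summits.Ventures.PercRepro2.Graph
import Summits.Ventures.PercRepro2.OneColourSwitch
import Summits.Ventures.PercRepro2.RegionHubSign
import Summits.Ventures.PercRepro2.SideSwitch
import Summits.Ventures.PercRepro2.SideSwitchFibre
import Summits.Ventures.PercRepro2.SideSwitchMono
import Summits.Ventures.PercRepro2.SideSwitchM9
import Summits.Ventures.PercRepro2.SideSwitchClosed
import Summits.Ventures.PercRepro2.SideSwitchComps
import Summits.Ventures.PercRepro2.SideSwitchCompsFibre
import Summits.Ventures.PercRepro2.SideSwitchCompsMono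

/-!
# `m9` on the class with no doubly reached non-mark: the class theorem of
`proofs/P3-CPNC.md` §14i ∪ §14o in the kernel (blind cell PercRepro2, p3 g18, 2026-08-27; §15)

For a finite multigraph with marks `p, q, r, s` such that, in every `Sep`-colouring, no vertex
other than `r, s` lies in both worlds of `{r, s}` (`DZero` — e.g. every non-mark is adjacent to
`p` or `q`, or is pendant), `Σ_{Sep} σ_pq · σ_rs ≤ 0` (`m9SignSum_nonpos_of_DZero`,
`m9SignSum_nonpos_of_adj_or_pendant'`).  Proof: the `Sep`-colourings are fibred over the
representatives `ρ` by the hypercube `2^{comps ρ}` of component assignments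
(`sum_sep_eq_sum_rep_comps`); on each fibre `σ_pq(ρ_T) + σ_pq(ρ^O_T) = G(T) − G(comps ∖ T)` with
`G` increasing and `σ_rs(ρ_T)` decreasing (`SideSwitchCompsMono`); Harris on the uniform
hypercube (`harris_powerset`) with `Σ_T (G(T) − G(comps ∖ T)) = 0` closes.  Own work; std axioms.
-/

namespace Summit.Ventures.PercRepro2

namespace SideSwitch

open Finset Classical RegionHub OneColourSwitch

variable {V : Type*} {E : Type*}

section Count

variable [Fintype V] [DecidableEq V] [Fintype E] [DecidableEq E]

variable {ends : E → Sym2 V}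

omit [Fintype E] [DecidableEq E] in
/-- The outside is preserved by a component assignment. -/
lemma Oset_assignC {p q r s : V} {ρ : Config E} (h : sep2 ends p q r s ρ)
    {T : Finset (Finset V)} (hT : T ⊆ comps ends r s ρ) :
    Oset ends r s (assignC ends T ρ) = Oset ends r s ρ := by
  obtain ⟨h1, h2, h3, h4⟩ := switch_data_unionT hT
  simp only [Oset, assignC, assign]
  rw [U2_flipTouch_of_closed h h1 h2 h3 h4]

omit [Fintype E] [DecidableEq E] in
/-- The components are preserved by `flipO`. -/
lemma comps_flipO (r s : V) (ρ : Config E) :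
    comps ends r s (flipO ends r s ρ) = comps ends r s ρ := by
  simp only [comps, A0_flipO]

/-- `σ_rs` of the component assignment of the outside-flipped representative. -/
lemma sigma_rs_assignC_flipO {p q r s : V} {ρ : Config E} (hρ : ρ ∈ Rep ends p q r s)
    {T : Finset (Finset V)} (hT : T ⊆ comps ends r s ρ) :
    sigma ends (assignC ends T (flipO ends r s ρ)) r s = sigma ends (assignC ends T ρ) r s := by
  have h : assignC ends T (flipO ends r s ρ) =
      flipIn ends (Oset ends r s (assignC ends T ρ)) (assignC ends T ρ) := by
    rw [Oset_assignC (mem_Rep.1 hρ).1 hT]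
    simp only [flipO, assignC, assign]
    exact (flipIn_flipTouch _ _ _).symm
  rw [h, sigma_rs_flipIn_Oset]

/-- **The per-representative identity** for component assignments:
`σ_pq(ρ_T) + σ_pq(ρ^O_T) = G(T) − G(comps ∖ T)`. -/
lemma sigma_pq_add_flipO_C {p q r s : V} {ρ : Config E} (hρ : ρ ∈ Rep ends p q r s)
    {T : Finset (Finset V)} (hT : T ⊆ comps ends r s ρ) :
    sigma ends (assignC ends T ρ) p q + sigma ends (assignC ends T (flipO ends r s ρ)) p q =
      ((if Conn ends (assignC ends T ρ) p q then (1 : ℤ) else 0) +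
        (if Conn ends (assignC ends T (flipO ends r s ρ)) p q then 1 else 0)) -
      ((if Conn ends (assignC ends (comps ends r s ρ \ T) ρ) p q then (1 : ℤ) else 0) +
        (if Conn ends (assignC ends (comps ends r s ρ \ T) (flipO ends r s ρ)) p q then 1
          else 0)) := by
  have hρO := flipO_mem_Rep hρ
  have hTO : T ⊆ comps ends r s (flipO ends r s ρ) := by rw [comps_flipO]; exact hT
  have e1 := conn_pq_compl_assignC hρ hT
  have e2 := conn_pq_compl_assignC hρO hTO
  rw [comps_flipO, flipO_flipO] at e2
  unfold sigma
  simp only [e1, e2]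
  ring

/-- **`m9` in sign form when no non-mark is doubly reached**: `Σ_{Sep} σ_pq · σ_rs ≤ 0`. -/
theorem m9SignSum_nonpos_of_DZero {p q r s : V}
    (hD : ∀ ω, sep2 ends p q r s ω → DZero ends r s ω) : m9SignSum ends p q r s ≤ 0 := by
  have hsum : m9SignSum ends p q r s =
      ∑ ρ ∈ Rep ends p q r s, ∑ T ∈ (comps ends r s ρ).powerset,
        sigma ends (assignC ends T ρ) p q * sigma ends (assignC ends T ρ) r s := by
    rw [m9SignSum, ← Finset.sum_filter]
    exact sum_sep_eq_sum_rep_comps hD (fun ω => sigma ends ω p q * sigma ends ω r s)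
  have hsumO : (∑ ρ ∈ Rep ends p q r s, ∑ T ∈ (comps ends r s ρ).powerset,
        sigma ends (assignC ends T ρ) p q * sigma ends (assignC ends T ρ) r s) =
      ∑ ρ ∈ Rep ends p q r s, ∑ T ∈ (comps ends r s ρ).powerset,
        sigma ends (assignC ends T (flipO ends r s ρ)) p q *
          sigma ends (assignC ends T ρ) r s := by
    symm
    refine Finset.sum_nbij' (fun ρ => flipO ends r s ρ) (fun ρ => flipO ends r s ρ)
      (fun ρ hρ => flipO_mem_Rep hρ) (fun ρ hρ => flipO_mem_Rep hρ)
      (fun ρ _ => flipO_flipO r s ρ) (fun ρ _ => flipO_flipO r s ρ) ?_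
    intro ρ hρ
    rw [comps_flipO]
    refine Finset.sum_congr rfl (fun T hT => ?_)
    rw [sigma_rs_assignC_flipO hρ (Finset.mem_powerset.1 hT)]
  have hkey : ∀ ρ ∈ Rep ends p q r s,
      ∑ T ∈ (comps ends r s ρ).powerset,
        (sigma ends (assignC ends T ρ) p q +
          sigma ends (assignC ends T (flipO ends r s ρ)) p q) *
          sigma ends (assignC ends T ρ) r s ≤ 0 := by
    intro ρ hρ
    set A := comps ends r s ρ with hA
    let Yc : Finset (Finset V) → ℤ := fun T => if Conn ends (assignC ends T ρ) p q then 1 else 0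
    let Yc' : Finset (Finset V) → ℤ := fun T =>
      if Conn ends (assignC ends T (flipO ends r s ρ)) p q then 1 else 0
    let G : Finset (Finset V) → ℤ := fun T => Yc T + Yc' T
    let D : Finset (Finset V) → ℤ := fun T => G T - G (A \ T)
    let S : Finset (Finset V) → ℤ := fun T => sigma ends (assignC ends T ρ) r s
    have hρO := flipO_mem_Rep hρ
    have hmonoYc : ∀ T T', T ⊆ T' → T' ⊆ A → Yc T ≤ Yc T' := by
      intro T T' hTT hT'
      exact ite_le_ite_of_imp (conn_pq_assignC_mono hρ hTT hT')
    have hmonoYc' : ∀ T T', T ⊆ T' → T' ⊆ A → Yc' T ≤ Yc' T' := by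
      intro T T' hTT hT'
      have hT'O : T' ⊆ comps ends r s (flipO ends r s ρ) := by rw [comps_flipO]; exact hT'
      exact ite_le_ite_of_imp (conn_pq_assignC_mono hρO hTT hT'O)
    have hmonoD : ∀ T T', T ⊆ T' → T' ⊆ A → D T ≤ D T' := by
      intro T T' hTT hT'
      have h1 := hmonoYc T T' hTT hT'
      have h2 := hmonoYc' T T' hTT hT'
      have h3 := hmonoYc (A \ T') (A \ T) (Finset.sdiff_subset_sdiff (Finset.Subset.refl A) hTT)
        Finset.sdiff_subset
      have h4 := hmonoYc' (A \ T') (A \ T) (Finset.sdiff_subset_sdiff (Finset.Subset.refl A) hTT)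
        Finset.sdiff_subset
      simp only [D, G]
      linarith
    have hantiS : ∀ T T', T ⊆ T' → T' ⊆ A → S T' ≤ S T := by
      intro T T' hTT hT'
      show sigma ends (assignC ends T' ρ) r s ≤ sigma ends (assignC ends T ρ) r s
      unfold sigma
      exact sub_le_sub (ite_le_ite_of_imp (conn_rs_assignC_anti hρ hTT hT'))
        (ite_le_ite_of_imp (conn_rs_compl_assignC_mono hρ hTT hT'))
    have h0 : ∑ T ∈ A.powerset, D T = 0 := by
      simp only [D]
      rw [Finset.sum_sub_distrib, sum_powerset_sdiff, sub_self]
    have hH := sum_mul_nonpos_of_monotone_antitone A D S hmonoD hantiS h0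
    refine le_trans (le_of_eq ?_) hH
    refine Finset.sum_congr rfl (fun T hT => ?_)
    rw [sigma_pq_add_flipO_C hρ (Finset.mem_powerset.1 hT)]
  have htwice : 2 * m9SignSum ends p q r s ≤ 0 := by
    calc 2 * m9SignSum ends p q r s
        = m9SignSum ends p q r s + m9SignSum ends p q r s := by ring
      _ = (∑ ρ ∈ Rep ends p q r s, ∑ T ∈ (comps ends r s ρ).powerset,
            sigma ends (assignC ends T ρ) p q * sigma ends (assignC ends T ρ) r s) +
          ∑ ρ ∈ Rep ends p q r s, ∑ T ∈ (comps ends r s ρ).powerset,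
            sigma ends (assignC ends T (flipO ends r s ρ)) p q *
              sigma ends (assignC ends T ρ) r s := by
          rw [← hsumO, ← hsum]
      _ = ∑ ρ ∈ Rep ends p q r s, ∑ T ∈ (comps ends r s ρ).powerset,
            (sigma ends (assignC ends T ρ) p q +
              sigma ends (assignC ends T (flipO ends r s ρ)) p q) *
              sigma ends (assignC ends T ρ) r s := by
          rw [← Finset.sum_add_distrib]
          refine Finset.sum_congr rfl (fun ρ _ => ?_)
          rw [← Finset.sum_add_distrib]
          refine Finset.sum_congr rfl (fun T _ => ?_)
          ring
      _ ≤ 0 := Finset.sum_nonpos (fun ρ hρ => hkey ρ hρ)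
  linarith

/-- **`m9` in sign form on the class «every non-mark is adjacent to `p` or `q`»** (the class
theorem of `proofs/P3-CPNC.md` §14i): `Σ_{Sep} σ_pq · σ_rs ≤ 0`. -/
theorem m9SignSum_nonpos_of_adj' {p q r s : V}
    (hadj : ∀ x, Nonmark p q r s x → ∃ e, ends e = s(x, p) ∨ ends e = s(x, q)) :
    m9SignSum ends p q r s ≤ 0 :=
  m9SignSum_nonpos_of_DZero (fun _ h => DZero_of_adj hadj h)

/-- **`m9` in sign form on the class «every non-mark is adjacent to `p` or `q`, or is
pendant»** (`proofs/P3-CPNC.md` §14i ∪ §14o): `Σ_{Sep} σ_pq · σ_rs ≤ 0`. -/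
theorem m9SignSum_nonpos_of_adj_or_pendant' {p q r s : V}
    (hadj : ∀ x, Nonmark p q r s x →
      (∃ e, ends e = s(x, p) ∨ ends e = s(x, q)) ∨ ∃ e₁, Pendant ends x e₁) :
    m9SignSum ends p q r s ≤ 0 :=
  m9SignSum_nonpos_of_DZero (fun _ h => DZero_of_adj_or_pendant hadj h)

end Count

end SideSwitch

end Summit.Ventures.PercRepro2
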